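import Literature.AlgebraicTopology.Homotopy.StrongDeformationRetract
import Mathlib.Analysis.InnerProductSpace.PiL2
import Mathlib.Topology.OpenPartialHomeomorph.Basic
import HarnessLib

/-!
# Radial collars in a chart (pieces for the π₁ computation of the stabilisation, II)

Topic `Literature/Topology/FourManifolds`; infrastructure for the fact seat
`provefact-Literature.Topology.FourManifolds.exists-14560f9fc8` (named fact (c′)
`Literature.Topology.FourManifolds.exists_stabilized_gkTrisection`; the collar hypotheses of the
`π₁` stage `exists_marking_groupGKTrisectionOf_eq_stabilize`, `TrisectionFunctorGKStabilizationPi1.lean`).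
Everything in this file is **proved**; no definitions, no named facts.

**Theorem (`isStrongDeformationRetractOf_radial`).**  Let `Θ` be a local homeomorphism of `X`
into `ℝ⁴`, `c` a point with `closedBall c b ⊆ Θ.target`, `J ⊆ (0, b]` an order-connected set of
radii containing `r`, and `W ⊆ X` a subset which, read in the chart over the radii in `J`, is
invariant under the radial rescalings `z ↦ c + s (z - c)` keeping the radius in `J`.  Then the
"sphere slice" `W ∩ {‖Θ y - c‖ = r}` is a strong deformation retract of the "shell slice"
`W ∩ {‖Θ y - c‖ ∈ J}`, by the radial homotopy
`H(t, y) = Θ⁻¹ (c + ((1 - t) + t r / ‖Θ y - c‖)(Θ y - c))` (Hatcher, Ch. 0: deformation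
retractions of annuli onto spheres, transported through the chart).  This gives at once the
collars of the interface circle `C` in the old and new central surfaces and of the interface
discs `Eᵢ` in the old and new handlebodies of Gay–Kirby's stabilisation performed in a chart
ball (`TrisectionsStabilizationPieces.lean`), since planes and half-spaces through `c` and the
unchanged region are radially invariant.

## References

* A. Hatcher, *Algebraic Topology* (2002), Ch. 0 (deformation retractions; Ex. 0.2).
  [HatcherAT2002]
* A. Abrams, D. Gay, R. Kirby, *Group trisections and smooth 4-manifolds*, Geom. Topol. 22
  (2018), proof of Thm. 5 (p. 1542). [AbramsGayKirby2018]
-/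

open Set Function Filter Metric
open scoped Topology

noncomputable section

namespace Literature.Topology.FourManifolds

universe u

section Radial

variable {X : Type u} [TopologicalSpace X]

/-- **Radial collars in a chart.**  See the module docstring.
[cite: HatcherAT2002, Ch. 0 (deformation retractions, Ex. 0.2)] -/
theorem isStrongDeformationRetractOf_radial (Θ : OpenPartialHomeomorph X (EuclideanSpace ℝ (Fin 4)))
    {c : EuclideanSpace ℝ (Fin 4)} {r b : ℝ} (hr : 0 < r) (hball : closedBall c b ⊆ Θ.target)
    {J : Set ℝ} (hJ : J.OrdConnected) (hrJ : r ∈ J) (hJpos : ∀ s ∈ J, 0 < s) (hJb : ∀ s ∈ J, s ≤ b)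
    {W : Set X}
    (hW : ∀ y ∈ Θ.source, y ∈ W → ‖Θ y - c‖ ∈ J → ∀ s : ℝ, 0 < s → s * ‖Θ y - c‖ ∈ J →
      Θ.symm (c + s • (Θ y - c)) ∈ W) :
    Literature.AlgebraicTopology.Homotopy.IsStrongDeformationRetractOf
      (W ∩ {y | y ∈ Θ.source ∧ ‖Θ y - c‖ = r})
      (W ∩ {y | y ∈ Θ.source ∧ ‖Θ y - c‖ ∈ J}) := by
  set S : Set X := W ∩ {y | y ∈ Θ.source ∧ ‖Θ y - c‖ ∈ J} with hS
  -- the rescaling factor and the homotopy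
  set lam : ℝ → X → ℝ := fun t y => (1 - t) + t * (r / ‖Θ y - c‖) with hlam
  set H : ℝ → X → X := fun t y => Θ.symm (c + lam t y • (Θ y - c)) with hH
  -- basic estimates for `y ∈ S`, `t ∈ [0, 1]`
  have key : ∀ t ∈ Icc (0:ℝ) 1, ∀ y ∈ S,
      0 < lam t y ∧ lam t y * ‖Θ y - c‖ ∈ J ∧ c + lam t y • (Θ y - c) ∈ Θ.target ∧
        ‖(c + lam t y • (Θ y - c)) - c‖ = lam t y * ‖Θ y - c‖ := by
    intro t ht y hy
    obtain ⟨-, hysrc, hyJ⟩ := hy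
    set n : ℝ := ‖Θ y - c‖ with hn
    have hnpos : 0 < n := hJpos n hyJ
    have hlam_eq : lam t y * n = (1 - t) * n + t * r := by
      show ((1 - t) + t * (r / ‖Θ y - c‖)) * n = (1 - t) * n + t * r
      rw [← hn]; field_simp
    -- the radius `(1 - t) n + t r` lies between `n` and `r`, hence in `J`
    have hseg : (1 - t) * n + t * r ∈ J := by
      rcases le_total n r with hnr | hrn
      · refine hJ.out hyJ hrJ ⟨?_, ?_⟩ <;> nlinarith [ht.1, ht.2]
      · refine hJ.out hrJ hyJ ⟨?_, ?_⟩ <;> nlinarith [ht.1, ht.2]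
    have hlampos : 0 < lam t y := by
      have h1 : 0 < lam t y * n := by rw [hlam_eq]; exact hJpos _ hseg
      exact pos_of_mul_pos_left h1 hnpos.le
    have hnorm : ‖(c + lam t y • (Θ y - c)) - c‖ = lam t y * n := by
      rw [add_sub_cancel_left, norm_smul, Real.norm_eq_abs, abs_of_pos hlampos]
    refine ⟨hlampos, by rw [hlam_eq]; exact hseg, hball ?_, hnorm⟩
    rw [mem_closedBall, dist_eq_norm, hnorm, hlam_eq]
    exact hJb _ hseg
  have hmaps : ∀ t ∈ Icc (0:ℝ) 1, MapsTo (H t) S S := by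
    intro t ht y hy
    obtain ⟨hlampos, hJmem, htgt, hnorm⟩ := key t ht y hy
    have hsrc : H t y ∈ Θ.source := Θ.map_target htgt
    have hΘH : Θ (H t y) = c + lam t y • (Θ y - c) := Θ.right_inv htgt
    refine ⟨hW y hy.2.1 hy.1 hy.2.2 (lam t y) hlampos hJmem, hsrc, ?_⟩
    rw [hΘH, hnorm]; exact hJmem
  have h0 : ∀ y ∈ S, H 0 y = y := by
    intro y hy
    simp only [hH, hlam, sub_zero, zero_mul, add_zero, one_smul, add_sub_cancel]
    exact Θ.left_inv hy.2.1
  have h1 : ∀ y ∈ S, H 1 y ∈ W ∩ {y | y ∈ Θ.source ∧ ‖Θ y - c‖ = r} := by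
    intro y hy
    have ht : (1:ℝ) ∈ Icc (0:ℝ) 1 := ⟨zero_le_one, le_rfl⟩
    obtain ⟨hlampos, hJmem, htgt, hnorm⟩ := key 1 ht y hy
    have hmem := hmaps 1 ht hy
    refine ⟨hmem.1, hmem.2.1, ?_⟩
    rw [show H 1 y = Θ.symm (c + lam 1 y • (Θ y - c)) from rfl, Θ.right_inv htgt, hnorm]
    have hnpos : 0 < ‖Θ y - c‖ := hJpos _ hy.2.2
    simp only [hlam, sub_self, zero_add, one_mul]
    field_simp
  have hfix : ∀ t ∈ Icc (0:ℝ) 1, ∀ y ∈ S, y ∈ W ∩ {y | y ∈ Θ.source ∧ ‖Θ y - c‖ = r} → H t y = y := by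
    intro t _ y hy hyC
    have hnr : ‖Θ y - c‖ = r := hyC.2.2
    have hl : lam t y = 1 := by simp only [hlam, hnr, div_self hr.ne']; ring
    simp only [hH, hl, one_smul, add_sub_cancel]
    exact Θ.left_inv hy.2.1
  -- continuity on `[0, 1] × S`
  have hcont : ContinuousOn (fun p : ℝ × X => H p.1 p.2) (Icc (0:ℝ) 1 ×ˢ S) := by
    have hΘc : ContinuousOn (fun p : ℝ × X => Θ p.2) (Icc (0:ℝ) 1 ×ˢ S) :=
      Θ.continuousOn.comp continuous_snd.continuousOn fun p hp => hp.2.2.1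
    have hnorm_c : ContinuousOn (fun p : ℝ × X => ‖Θ p.2 - c‖) (Icc (0:ℝ) 1 ×ˢ S) :=
      (hΘc.sub continuousOn_const).norm
    have hnorm_ne : ∀ p ∈ Icc (0:ℝ) 1 ×ˢ S, ‖Θ p.2 - c‖ ≠ 0 := fun p hp =>
      (hJpos _ hp.2.2.2).ne'
    have hlam_c : ContinuousOn (fun p : ℝ × X => lam p.1 p.2) (Icc (0:ℝ) 1 ×ˢ S) := by
      simp only [hlam]
      refine ((continuousOn_const.sub continuous_fst.continuousOn).add
        (continuous_fst.continuousOn.mul (continuousOn_const.div hnorm_c hnorm_ne)))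
    have hinner : ContinuousOn (fun p : ℝ × X => c + lam p.1 p.2 • (Θ p.2 - c)) (Icc (0:ℝ) 1 ×ˢ S) :=
      continuousOn_const.add (hlam_c.smul (hΘc.sub continuousOn_const))
    refine Θ.continuousOn_symm.comp hinner fun p hp => ?_
    exact (key p.1 hp.1 p.2 hp.2).2.2.1
  exact Literature.AlgebraicTopology.Homotopy.IsStrongDeformationRetractOf.of_continuousOn H hcont hmaps
    h0 h1 hfix

end Radial

end Literature.Topology.FourManifolds
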